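import Summits.HodgeConjecture.CorCM.GaloisQuaternionCyclicPrimeTwoSheet
import Summits.HodgeConjecture.CorCM.GaloisDicyclicNondegenerate
import HarnessLib

/-!
# Galois CM fields with group `Q₈ × C_p`: every primitive CM type is nondegenerate as soon as `−1` is not a sum of two
# squares in `ℚ(ζ_p)` — the Hodge conjecture for all powers of their simple CM abelian `4p`-folds

COR-CM (cell `pub-hodgecm2`), binder seat b04 (gen 25), count-neutral claim QUATERNION-CYCLIC-PRIME, part II (the theorem on
CM fields; part I `CorCM/GaloisQuaternionCyclicPrimeTwoSheet` is the group-theoretic core, part III supplies the arithmetic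
hypothesis for `ord_p(2)` odd).  KERNEL ONLY: theorems; no definition, no named fact, no `sorry`.  `HC_CM` is neither used
nor claimed: this is the Hodge conjecture for a NAMED CLASS of CM abelian varieties, modulo ONE explicit, elementary field
hypothesis (discharged in part IV for `p = 7, 23, 31, 47, 71, 73, 79, …`).

SETTING.  `K` a Galois CM field with `Gal(K/ℚ) ≅ Q₈ × C_p`, `p` an odd prime: `K = L·M` with `L` a `Q₈`-CM field (degree
`8`) and `M` a real cyclic field of degree `p`; `[K:ℚ] = 8p`; complex conjugation is the UNIQUE involution `(a 2, 1)`
(`eq_of_mul_self_eq_one`).  Gen 24 (`CorCM/GaloisRealFactorDegenerate`) showed that a totally real Galois factor of group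
`H ∉ {1, C₂, C₂², C₂³, C₄, C_p, S₃}` is fatal; for `H = C_p` against `Q₈` the answer is ARITHMETIC: the two-sheet determinant
of part I is a sum of two norms `N_{ℚ(ζ_p)(i)/ℚ(ζ_p)}`, so

THEOREM (`isNondegenerate_of_isPrimitive_quaternion_cyclic`).  If `−1` is not a sum of two squares in a subfield `E ⊆ ℂ`
containing the `p`-th roots of unity (equivalently in `ℚ(ζ_p)`; by the local square theorem at `2` this holds iff
`ord_p(2)` is ODD — `p = 7, 23, 31, 47, 71, 73, 79, 89, …`), then EVERY PRIMITIVE CM type `Φ` of `K` is NONDEGENERATE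
(Kubota rank `4p + 1`), hence (`hodgeConjectureFor_pow_of_isSimple_quaternion_cyclic`) every SIMPLE abelian variety of
dimension `4p` with complex multiplication by `K` satisfies `Bᵐ(Aⁿ) ⊗ ℂ = Dᵐ(Aⁿ) ⊗ ℂ` and the HODGE CONJECTURE together
with ALL ITS POWERS.  The hypothesis is sharp: `Q₈ × C₃` (order 24, gen 20), `Q₈ × C₅`, `Q₈ × C₁₁` (gen 24, kernel
certificates `CorCM/GaloisQuaternionCyclicFiveDegenerate`, `…ElevenDegenerate`) carry primitive DEGENERATE types — there
`ord_p(2) = 2, 4, 10` is even and `−1` IS a sum of two squares in `ℚ(ζ_p)`.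

* §1 `eq_of_mul_self_eq_one`, `map_complexConj_eq`, `finrank_eq` — the unique involution of `Q₈ × C_p`; `[K:ℚ] = 8p`.
* §2 **`isNondegenerate_of_isPrimitive_quaternion_cyclic`**, `cmTypeRank_eq_of_isPrimitive_quaternion_cyclic`.
* §3 `hodgeConjectureFor_pow_of_isSimple_quaternion_cyclic`, `hodgeConjectureFor_of_isSimple_quaternion_cyclic`,
  `hodgeClassSpan_pow_eq_divisorClassesSpan_of_isSimple_quaternion_cyclic`.

## References

* [Kubota1965] T. Kubota, Trans. AMS 118 (1965), §2 (rank; nondegenerate ⟹ primitive), §4 Lemma 2.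
* [Dodson1984] B. Dodson, *The structure of Galois groups of CM-fields*, Trans. AMS 283 (1984), §3.1, §5.3.
* [Shimura1998] G. Shimura, *Abelian Varieties with Complex Multiplication and Modular Functions*, §8.2 Prop. 26.
* [Gordon1999HodgeAVSurvey] B. B. Gordon, *A survey of the Hodge conjecture for abelian varieties*, Thm. 6.4, §9.4.
-/

noncomputable section

open CategoryTheory CategoryTheory.Limits NumberField
open scoped BigOperators

namespace Summit.HodgeConjecture.CorCM.GaloisQuaternionCyclic

open Literature.NumberTheory.ComplexMultiplication
open Literature.AlgebraicGeometry.Motives (AbelianVariety CMType)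
open Literature.AlgebraicGeometry.HodgeTheory
open Literature.AlgebraicGeometry.ComplexMultiplication (IsCMTypeRealisation isSimple_iff_isPrimitive)
open Literature.AlgebraicGeometry.Pohlmann1968
open Summit.HodgeConjecture.CorCM.GaloisRank
open QuaternionGroup

/-! ## §1 The involution of `Q₈ × C_p` and complex conjugation -/

section Involution

variable {p : ℕ} [Fact p.Prime]

/-- In `C_p` (`p` an odd prime) the only element of order `≤ 2` is `1`. [folklore] -/
theorem eq_one_of_mul_self_eq_one_cyclic (hp2 : p ≠ 2) (v : Multiplicative (ZMod p)) (hv : v * v = 1) : v = 1 := by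
  have hp : p.Prime := Fact.out
  have h2 : (2 : ZMod p) ≠ 0 := by
    rw [Ne, show (2 : ZMod p) = ((2 : ℕ) : ZMod p) by norm_num, ZMod.natCast_eq_zero_iff]
    intro h
    exact hp2 ((Nat.prime_dvd_prime_iff_eq hp Nat.prime_two).1 h)
  have h : (2 : ZMod p) * Multiplicative.toAdd v = 0 := by
    rw [two_mul, ← toAdd_mul, hv, toAdd_one]
  rcases mul_eq_zero.1 h with h | h
  · exact absurd h h2
  · rw [← ofAdd_toAdd v, h]; rfl

/-- **`(a 2, 1)` is the unique involution of `Q₈ × C_p`.** [cite: Dodson1984, §5.3] -/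
theorem eq_of_mul_self_eq_one (hp2 : p ≠ 2) (y : QuaternionGroup 2 × Multiplicative (ZMod p)) (hy : y * y = 1)
    (hy1 : y ≠ 1) : y = (a 2, 1) := by
  obtain ⟨q, v⟩ := y
  rw [Prod.mk_mul_mk, Prod.mk_eq_one] at hy
  have hv : v = 1 := eq_one_of_mul_self_eq_one_cyclic hp2 v hy.2
  subst hv
  have hq1 : q ≠ 1 := fun h => hy1 (by rw [h]; rfl)
  rw [GaloisDicyclic.eq_a_of_mul_self_eq_one q hy.1 hq1]
  norm_num

variable {K : Type} [Field K] [NumberField K] [IsCMField K]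

/-- Complex conjugation maps to `(a 2, 1)` under any isomorphism `Gal(K/ℚ) ≃ Q₈ × C_p`. [folklore] -/
theorem map_complexConj_eq (hp2 : p ≠ 2) (e : (K ≃ₐ[ℚ] K) ≃* QuaternionGroup 2 × Multiplicative (ZMod p)) :
    e ((IsCMField.complexConj K).restrictScalars ℚ) = (a 2, 1) :=
  eq_of_mul_self_eq_one hp2 _ (model_complexConj_mul_self e rfl) (model_complexConj_ne_one e rfl)

omit [IsCMField K] in
/-- `[K:ℚ] = 8p`. [folklore] -/
theorem finrank_eq [IsGalois ℚ K] (e : (K ≃ₐ[ℚ] K) ≃* QuaternionGroup 2 × Multiplicative (ZMod p)) :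
    Module.finrank ℚ K = 8 * p := by
  have hp : p.Prime := Fact.out
  haveI : NeZero p := ⟨hp.ne_zero⟩
  rw [← card_model_eq_finrank e, Fintype.card_prod, QuaternionGroup.card, Fintype.card_multiplicative, ZMod.card]

end Involution

/-! ## §2 Nondegeneracy -/

section Field

variable {p : ℕ} [Fact p.Prime]
variable {K : Type} [Field K] [NumberField K] [IsCMField K] [IsGalois ℚ K]

/-- **THEOREM.  `Gal(K/ℚ) ≅ Q₈ × C_p` (`p` an odd prime) and `−1` is not a sum of two squares in a subfield `E ⊆ ℂ`
containing the `p`-th roots of unity (e.g. `E = ℚ(ζ_p)` with `ord_p(2)` odd): every PRIMITIVE CM type of `K` is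
NONDEGENERATE.**  A vanishing two-sheet determinant `(X₁² + Y₁²) + (X₂² + Y₂²)` would make `(1, 4) ≠ 1` a left stabiliser
of the type read on `Q₈ × C_p`, contradicting primitivity (Shimura §8.2 Prop. 26). [cite: Kubota1965, §4 Lemma 2]
[cite: Shimura1998, §8.2 Prop. 26] -/
theorem isNondegenerate_of_isPrimitive_quaternion_cyclic (hp2 : p ≠ 2) (E : Subfield ℂ)
    (hEμ : ∀ z : ℂ, z ^ p = 1 → z ∈ E) (hE : ∀ x ∈ E, ∀ y ∈ E, x ^ 2 + y ^ 2 ≠ -1)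
    (e : (K ≃ₐ[ℚ] K) ≃* QuaternionGroup 2 × Multiplicative (ZMod p)) {Φ : CMType K} (φ₀ : K →+* ℂ)
    (hprim : IsPrimitive (ℂ ≃+* ℂ) Φ.1 φ₀) : IsNondegenerate Φ := by
  classical
  have hp : p.Prime := Fact.out
  haveI : NeZero p := ⟨hp.ne_zero⟩
  have hc := map_complexConj_eq hp2 e
  set S : Finset (QuaternionGroup 2 × Multiplicative (ZMod p)) :=
    Finset.univ.filter fun y => embOf φ₀ (e.symm y) ∈ Φ.1 with hS_def
  have hS : ∀ y, y ∈ S ↔ embOf φ₀ (e.symm y) ∈ Φ.1 := fun y => by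
    simp only [hS_def, Finset.mem_filter, Finset.mem_univ, true_and]
  have hScm := model_mul_mem_iff e hc Φ φ₀ S hS
  -- `(1, 4) ≠ 1` is not a left stabiliser (primitivity)
  have hv1 : (((1 : QuaternionGroup 2), Multiplicative.ofAdd (4 : ZMod p)) :
      QuaternionGroup 2 × Multiplicative (ZMod p)) ≠ 1 := by
    intro h
    rw [Prod.mk_eq_one] at h
    have h4 : (4 : ZMod p) = 0 := by
      have := congrArg Multiplicative.toAdd h.2
      simpa using this
    rw [show (4 : ZMod p) = ((2 ^ 2 : ℕ) : ZMod p) by norm_num, ZMod.natCast_eq_zero_iff] at h4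
    exact hp2 ((Nat.prime_dvd_prime_iff_eq hp Nat.prime_two).1 (hp.dvd_of_dvd_pow h4))
  have hstab : ¬ ∀ w : QuaternionGroup 2 × Multiplicative (ZMod p),
      w ∈ S ↔ ((1 : QuaternionGroup 2), Multiplicative.ofAdd (4 : ZMod p)) * w ∈ S :=
    fun h => not_isPrimitive_of_leftStabiliser e Φ φ₀ S hS hv1 h hprim
  exact (isNondegenerate_iff_forall_annihilator e hc Φ φ₀ S hS).2 fun b hb hann =>
    eq_zero_of_annihilated_quaternion_cyclic hp2 E hEμ hE S hScm hstab b hb hann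

/-- The rank: `cmTypeRank Φ = 4p + 1`. [cite: Kubota1965, §2 (p. 115)] -/
theorem cmTypeRank_eq_of_isPrimitive_quaternion_cyclic (hp2 : p ≠ 2) (E : Subfield ℂ)
    (hEμ : ∀ z : ℂ, z ^ p = 1 → z ∈ E) (hE : ∀ x ∈ E, ∀ y ∈ E, x ^ 2 + y ^ 2 ≠ -1)
    (e : (K ≃ₐ[ℚ] K) ≃* QuaternionGroup 2 × Multiplicative (ZMod p)) {Φ : CMType K} (φ₀ : K →+* ℂ)
    (hprim : IsPrimitive (ℂ ≃+* ℂ) Φ.1 φ₀) : cmTypeRank Φ = 4 * p + 1 := by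
  have h := isNondegenerate_of_isPrimitive_quaternion_cyclic hp2 E hEμ hE e φ₀ hprim
  rw [isNondegenerate_iff, finrank_eq e] at h
  rw [h]; omega

end Field

/-! ## §3 The Hodge conjecture for the simple CM abelian varieties and their powers -/

section Geometry

variable {p : ℕ} [Fact p.Prime]
variable {K : Type} [Field K] [NumberField K] [IsCMField K] [IsGalois ℚ K]
variable {Φ : CMType K} {A : AbelianVariety ℂ} {ι : 𝓞 K →+* End A}
  {θ : K →+* Module.End ℂ (complexBetti A.X 1)}

/-- **THE HODGE CONJECTURE FOR EVERY POWER OF EVERY SIMPLE ABELIAN VARIETY (of dimension `4p`) WITH COMPLEX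
MULTIPLICATION BY A GALOIS CM FIELD WITH GROUP `Q₈ × C_p`**, `p` an odd prime, provided `−1` is not a sum of two squares
in a subfield `E ⊆ ℂ` containing the `p`-th roots of unity (e.g. `ord_p(2)` odd).
[cite: Gordon1999HodgeAVSurvey, Thm. 6.4] [cite: Shimura1998, §8.2 Prop. 26] -/
theorem hodgeConjectureFor_pow_of_isSimple_quaternion_cyclic (hp2 : p ≠ 2) (E : Subfield ℂ)
    (hEμ : ∀ z : ℂ, z ^ p = 1 → z ∈ E) (hE : ∀ x ∈ E, ∀ y ∈ E, x ^ 2 + y ^ 2 ≠ -1)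
    (e : (K ≃ₐ[ℚ] K) ≃* QuaternionGroup 2 × Multiplicative (ZMod p)) (hA : IsCMTypeRealisation Φ A ι θ)
    (hs : A.IsSimple) (N : ℕ) :
    HodgeConjectureFor (⨁ fun _ : Fin N => A).dim (⨁ fun _ : Fin N => A).X := by
  obtain ⟨φ₀⟩ := (inferInstance : Nonempty (K →+* ℂ))
  exact (isNondegenerate_of_isPrimitive_quaternion_cyclic hp2 E hEμ hE e φ₀
    ((isSimple_iff_isPrimitive hA φ₀).1 hs)).hodgeConjectureFor_pow hA N

/-- The Hodge conjecture for the simple abelian variety itself. [cite: Gordon1999HodgeAVSurvey, Thm. 6.4] -/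
theorem hodgeConjectureFor_of_isSimple_quaternion_cyclic (hp2 : p ≠ 2) (E : Subfield ℂ)
    (hEμ : ∀ z : ℂ, z ^ p = 1 → z ∈ E) (hE : ∀ x ∈ E, ∀ y ∈ E, x ^ 2 + y ^ 2 ≠ -1)
    (e : (K ≃ₐ[ℚ] K) ≃* QuaternionGroup 2 × Multiplicative (ZMod p)) (hA : IsCMTypeRealisation Φ A ι θ)
    (hs : A.IsSimple) : HodgeConjectureFor A.dim A.X := by
  obtain ⟨φ₀⟩ := (inferInstance : Nonempty (K →+* ℂ))
  exact (isNondegenerate_of_isPrimitive_quaternion_cyclic hp2 E hEμ hE e φ₀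
    ((isSimple_iff_isPrimitive hA φ₀).1 hs)).hodgeConjectureFor hA

/-- `Bᵐ(Aⁿ) ⊗ ℂ = Dᵐ(Aⁿ) ⊗ ℂ` on every power of such a simple abelian variety (White–Hazama).
[cite: Gordon1999HodgeAVSurvey, §9.3] -/
theorem hodgeClassSpan_pow_eq_divisorClassesSpan_of_isSimple_quaternion_cyclic (hp2 : p ≠ 2) (E : Subfield ℂ)
    (hEμ : ∀ z : ℂ, z ^ p = 1 → z ∈ E) (hE : ∀ x ∈ E, ∀ y ∈ E, x ^ 2 + y ^ 2 ≠ -1)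
    (e : (K ≃ₐ[ℚ] K) ≃* QuaternionGroup 2 × Multiplicative (ZMod p)) (hA : IsCMTypeRealisation Φ A ι θ)
    (hs : A.IsSimple) (N m : ℕ) :
    Literature.AlgebraicGeometry.VanGeemen1994.hodgeClassSpan (⨁ fun _ : Fin N => A).dim (⨁ fun _ : Fin N => A).X m =
      Literature.Barriers.HodgeConjecture.divisorClassesSpan (⨁ fun _ : Fin N => A).X
        (⨁ fun _ : Fin N => A).dim m := by
  obtain ⟨φ₀⟩ := (inferInstance : Nonempty (K →+* ℂ))
  exact (isNondegenerate_of_isPrimitive_quaternion_cyclic hp2 E hEμ hE e φ₀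
    ((isSimple_iff_isPrimitive hA φ₀).1 hs)).hodgeClassSpan_pow_eq_divisorClassesSpan hA N m

omit [IsCMField K] in
/-- … and such a simple abelian variety has dimension `4p`. [cite: Shimura1998, §8.2 Prop. 26] -/
theorem dim_eq_of_quaternion_cyclic (e : (K ≃ₐ[ℚ] K) ≃* QuaternionGroup 2 × Multiplicative (ZMod p))
    (hA : IsCMTypeRealisation Φ A ι θ) : A.dim = 4 * p := by
  have h : A.dim = Module.finrank ℚ K / 2 := Literature.AlgebraicGeometry.Motives.schemeDim_eq_holds hA.1
  rw [finrank_eq e] at h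
  omega

end Geometry

end Summit.HodgeConjecture.CorCM.GaloisQuaternionCyclic

end
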